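import Summits.QuantumAdvantage.QuantumAdvantage.Theorems.SteerDialItems

/-!
# SteerDial (8/10): SteerDialLinear

§LIN — the first GLOBAL family of algebraic tests: `𝔽₃`-linear tests `{x : Σᵢ aᵢ[xᵢ] = t}` whose coefficient vector is `≡ 1`
on six cyclically consecutive positions and arbitrary elsewhere (`linRunLoss3_of_polyLoss3`, `rotLinRunLoss3_of_polyLoss3`,
`subsumRunLoss3_of_polyLoss3`: every sub-sum test over a set containing a 6-run) — the linear splice.

Part 8 of 10 of the prover-side twin of the workshop node «SteerDial» (route `SpreadDial`, node on 29065 `CoverLift3`;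
lineage decomp-qadv-lens-5, generation 7).  Content verbatim from the monolithic twin `tree/SpreadDialSteer.lean` v5
(sha256 in LAND.md, farm rc0 · 0 err · 0 warn · 0 sorry; axioms `propext`/`Classical.choice`/`Quot.sound` for every theorem),
cut at section boundaries to meet the 400-line rule.  No `def … : Prop`, no `instance`, no `notation`.
-/

set_option linter.style.longLine false
set_option linter.dupNamespace false

namespace Summit.QuantumAdvantage.QuantumAdvantage.Theorems.SteerDial

open Finset
open Literature.Computability.QuantumComplexity Literature.Computability.MetaComplexity
open Literature.Computability.QuantumComplexity.RingHLF
open Summit.QuantumAdvantage.AdviceFreeQNC0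
open Summit.QuantumAdvantage.QuantumAdvantage.Theses

/-! ## §LIN (v6)  The first GLOBAL family: `𝔽₃`-linear tests `{x : Σᵢ aᵢ[xᵢ] = t}` whose coefficient vector is `≡ 1` on six
cyclically consecutive positions (arbitrary on the other `n` positions) — `PolyLoss3 ⇒` poly loss inside every such test -/

section Linear
variable {n : ℕ}

/-- An `𝔽₃`-linear form in the input bits: `ℓ_a(x) = Σᵢ aᵢ [xᵢ]`. -/
def lin {N : ℕ} (a : Fin N → ZMod 3) (x : Fin N → Bool) : ZMod 3 := ∑ i, (if x i then a i else 0)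

/-- `ℓ_a` is the degree-1 polynomial `Σ aᵢ xᵢ`. -/
theorem lin_mem_lowDeg {N : ℕ} (a : Fin N → ZMod 3) :
    (fun x : Fin N → Bool => lin a x) ∈ Smolensky.lowDeg (ZMod 3) N 1 := by
  have h : (fun x : Fin N → Bool => lin a x) = ∑ i : Fin N, a i • Smolensky.mono (ZMod 3) {i} := by
    funext x
    simp only [lin, Finset.sum_apply, Pi.smul_apply, Smolensky.mono_apply, Finset.mem_singleton, forall_eq, smul_eq_mul]
    refine Finset.sum_congr rfl (fun i _ => ?_)
    cases x i <;> simp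
  rw [h]
  exact Submodule.sum_mem _ fun i _ => Submodule.smul_mem _ _ (Smolensky.mono_mem_lowDeg (by simp))

/-- The linear test `[ℓ_a(x) = t] = 1 - (ℓ_a - t)²` has degree 2. -/
theorem ind_lin_mem_lowDeg {N : ℕ} (a : Fin N → ZMod 3) (t : ZMod 3) :
    ind (fun x : Fin N → Bool => decide (lin a x = t)) ∈ Smolensky.lowDeg (ZMod 3) N 2 := by
  have h : ind (fun x : Fin N → Bool => decide (lin a x = t)) =
      ind (fun x => decide (((fun x : Fin N → Bool => lin a x) - (t - 1) • (1 : Smolensky.CubeFn (ZMod 3) N)) x = 1)) := by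
    funext x
    simp only [ind, Pi.sub_apply, Pi.smul_apply, Pi.one_apply, smul_eq_mul, mul_one]
    have e : (lin a x = t) ↔ (lin a x - (t - 1) = 1) := by
      constructor
      · intro h; rw [h]; ring
      · intro h; linear_combination h
    simp only [e]
  have h2 := ind_decide_mem_lowDeg (n := N) (d := 1)
    (Q := (fun x : Fin N → Bool => lin a x) - (t - 1) • (1 : Smolensky.CubeFn (ZMod 3) N))
    (Submodule.sub_mem _ (lin_mem_lowDeg a) (Submodule.smul_mem _ _ (one_mem_lowDeg _)))
  rw [h]
  exact Smolensky.lowDeg_mono (le_of_eq (by norm_num)) h2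

/-- Body part `a|_{[0,n)}` of a coefficient vector on `C_{n+6}`. -/
def bodyCoef (a : Fin (n + 6) → ZMod 3) : Fin n → ZMod 3 := fun i => a (Fin.castAdd 6 i)
/-- Window part `a|_{[n,n+6)}`. -/
def winCoef (a : Fin (n + 6) → ZMod 3) : Fin 6 → ZMod 3 := fun j => a (Fin.natAdd n j)

/-- SteerDial helper `lin_pad` (lens-5 g7 SteerDial twin; see the enclosing section docstring). -/
theorem lin_pad (a : Fin (n + 6) → ZMod 3) (w : Fin 6 → Bool) (y : Fin n → Bool) :
    lin a (pad w y) = lin (bodyCoef a) y + lin (winCoef a) w := by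
  unfold lin bodyCoef winCoef
  rw [Fin.sum_univ_add]
  simp only [pad_castAdd, pad_natAdd]

/-- SteerDial helper `lin_winCoef` (lens-5 g7 SteerDial twin; see the enclosing section docstring). -/
theorem lin_winCoef (a : Fin (n + 6) → ZMod 3) (ha : ∀ j : Fin 6, a (Fin.natAdd n j) = 1) (w : Fin 6 → Bool) :
    lin (winCoef a) w = lvl w := by
  unfold lin winCoef lvl
  exact Finset.sum_congr rfl (fun j _ => by rw [ha j])

/-- The LINEAR SPLICE: at a body pattern `y` with `ℓ_B(y) = ρ` play the fold of `P` along the identity word of weight `t - ρ`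
(so that the padded input lands exactly in the test `{ℓ_a = t}`); the selectors `[ℓ_B = ρ]` have degree 2. -/
def spliceLin (a : Fin (n + 6) → ZMod 3) (t : ZMod 3) (P : Fin (n + 6) → Smolensky.CubeFn (ZMod 3) (n + 6)) :
    Fin n → Smolensky.CubeFn (ZMod 3) n :=
  fun i => ∑ ρ : ZMod 3, ind (fun y => decide (lin (bodyCoef a) y = ρ)) *
    ind (foldBit (wsel (t - ρ)) (αsel (t - ρ)) (βsel (t - ρ)) (asel (t - ρ)) (bsel (t - ρ)) P i)

/-- The steering embedding `y ↦ (y, w_{t - ℓ_B(y)})`. -/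
def spliceLinEmb (a : Fin (n + 6) → ZMod 3) (t : ZMod 3) (y : Fin n → Bool) : Fin (n + 6) → Bool :=
  pad (wsel (t - lin (bodyCoef a) y)) y

/-- SteerDial helper `spliceLin_bits` (lens-5 g7 SteerDial twin; see the enclosing section docstring). -/
theorem spliceLin_bits (a : Fin (n + 6) → ZMod 3) (t : ZMod 3) (P : Fin (n + 6) → Smolensky.CubeFn (ZMod 3) (n + 6))
    (y : Fin n → Bool) (i : Fin n) :
    decide (spliceLin a t P i y = 1) =
      foldOut n (αsel (t - lin (bodyCoef a) y)) (βsel (t - lin (bodyCoef a) y)) (asel (t - lin (bodyCoef a) y))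
        (bsel (t - lin (bodyCoef a) y)) (bits P (spliceLinEmb a t y)) i := by
  unfold spliceLin
  rw [Finset.sum_apply, Fintype.sum_eq_single (lin (bodyCoef a) y)]
  · rw [Pi.mul_apply, show ind (fun y' : Fin n → Bool => decide (lin (bodyCoef a) y' = lin (bodyCoef a) y)) y = 1 by
        simp [ind], one_mul, decide_ind_eq_one]
    rfl
  · intro ρ hρ
    rw [Pi.mul_apply, show ind (fun y' : Fin n → Bool => decide (lin (bodyCoef a) y' = ρ)) y = 0 by
      simp only [ind, decide_eq_true_eq]; rw [if_neg (Ne.symm hρ)], zero_mul]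

/-- Degree of the linear splice: `≤ 2 + 14d`. -/
theorem spliceLin_mem_lowDeg {d : ℕ} (a : Fin (n + 6) → ZMod 3) (t : ZMod 3)
    {P : Fin (n + 6) → Smolensky.CubeFn (ZMod 3) (n + 6)} (hP : ∀ b, P b ∈ Smolensky.lowDeg (ZMod 3) (n + 6) d) (i : Fin n) :
    spliceLin a t P i ∈ Smolensky.lowDeg (ZMod 3) n (2 + 14 * d) := by
  unfold spliceLin
  exact Submodule.sum_mem _ fun ρ _ =>
    Smolensky.mul_mem_lowDeg_add (ind_lin_mem_lowDeg (bodyCoef a) ρ) (ind_foldBit_mem_lowDeg _ _ _ _ _ hP i)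

/-- The embedding lands exactly in the test `{ℓ_a = t}`. -/
theorem lin_spliceLinEmb {a : Fin (n + 6) → ZMod 3} (ha : ∀ j : Fin 6, a (Fin.natAdd n j) = 1) (t : ZMod 3) (y : Fin n → Bool) :
    lin a (spliceLinEmb a t y) = t := by
  unfold spliceLinEmb
  rw [lin_pad, lin_winCoef a ha, lvl_wsel]
  ring

/-- SteerDial helper `spliceLinEmb_injective` (lens-5 g7 SteerDial twin; see the enclosing section docstring). -/
theorem spliceLinEmb_injective (a : Fin (n + 6) → ZMod 3) (t : ZMod 3) : Function.Injective (spliceLinEmb (n := n) a t) := by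
  intro y y' h
  funext i
  have := congrFun h (Fin.castAdd 6 i)
  simpa [spliceLinEmb, pad_castAdd] using this

/-- Loss transport: if the linear splice loses at `y` then `P` loses at the steered input. -/
theorem loss_transport_lin (hn : 3 ≤ n) (a : Fin (n + 6) → ZMod 3) (t : ZMod 3)
    (P : Fin (n + 6) → Smolensky.CubeFn (ZMod 3) (n + 6)) (y : Fin n → Bool)
    (hloss : ¬ RingHLF.Rel y (fun i => decide (spliceLin a t P i y = 1))) :
    ¬ RingHLF.Rel (spliceLinEmb a t y) (fun b => decide (P b (spliceLinEmb a t y) = 1)) := by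
  intro hwin
  apply hloss
  have hf : (fun i => decide (spliceLin a t P i y = 1)) =
      foldOut n (αsel (t - lin (bodyCoef a) y)) (βsel (t - lin (bodyCoef a) y)) (asel (t - lin (bodyCoef a) y))
        (bsel (t - lin (bodyCoef a) y)) (bits P (spliceLinEmb a t y)) := funext fun i => spliceLin_bits a t P y i
  rw [hf]
  exact rel_fold hn (by norm_num) (wordCert_sel (t - lin (bodyCoef a) y)) y (bits P (spliceLinEmb a t y)) hwin

/-- The loss count of the linear splice is at most the loss count of `P` inside the test `{ℓ_a = t}`. -/
theorem card_loss_spliceLin_le (hn : 3 ≤ n) {a : Fin (n + 6) → ZMod 3} (ha : ∀ j : Fin 6, a (Fin.natAdd n j) = 1) (t : ZMod 3)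
    (P : Fin (n + 6) → Smolensky.CubeFn (ZMod 3) (n + 6)) :
    (univ.filter fun y : Fin n → Bool => ¬ RingHLF.Rel y (fun i => decide (spliceLin a t P i y = 1))).card ≤
      (univ.filter fun x : Fin (n + 6) → Bool =>
        lin a x = t ∧ ¬ RingHLF.Rel x (fun b => decide (P b x = 1))).card := by
  refine Finset.card_le_card_of_injOn (spliceLinEmb a t) (fun y hy => ?_) (fun y _ y' _ h => spliceLinEmb_injective a t h)
  rw [Finset.mem_coe, Finset.mem_filter] at hy ⊢
  exact ⟨mem_univ _, lin_spliceLinEmb ha t y, loss_transport_lin hn a t P y hy.2⟩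

/-- **LinRunLoss3 (PROVED from PolyLoss3) — the first GLOBAL family of algebraic tests.**  For every coefficient vector
`a : C_{n+6} → 𝔽₃` that is `≡ 1` on the window `[n, n+6)` and ARBITRARY on the `n` body positions, every `t ∈ 𝔽₃` and every
polylog-degree strategy `P` on `C_{n+6}`: the loss set of `P` has mass `≥ 2^(n+6)/(n+6)^(k+6)` inside the linear test
`{x : Σᵢ aᵢ[xᵢ] = t}` (a degree-2 algebraic test `1 - (ℓ_a - t)²` depending on UNBOUNDEDLY many coordinates — outside the reach
of every window / junta theorem of §S–§C).  Proof: the linear splice (steer by the residue of the BODY form `ℓ_B(y)`, fold along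
`W0/W1/W2`).  `LevelSpread3` is the special case `a ≡ 1`. -/
theorem linRunLoss3_of_polyLoss3 (hP : SpreadDial.PolyLoss3) :
    ∃ k : ℕ, ∀ c : ℕ, ∃ n₀ : ℕ, ∀ n ≥ n₀, ∀ P : Fin (n + 6) → Smolensky.CubeFn (ZMod 3) (n + 6),
      (∀ b, P b ∈ Smolensky.lowDeg (ZMod 3) (n + 6) ((Nat.log 2 (n + 6)) ^ c)) →
        ∀ a : Fin (n + 6) → ZMod 3, (∀ j : Fin 6, a (Fin.natAdd n j) = 1) → ∀ t : ZMod 3,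
          1 / ((n + 6 : ℕ) : ℝ) ^ k * (2 : ℝ) ^ (n + 6) ≤
            ((univ.filter fun x : Fin (n + 6) → Bool =>
              lin a x = t ∧ ¬ RingHLF.Rel x (fun b => decide (P b x = 1))).card : ℝ) := by
  obtain ⟨k, hk⟩ := hP
  refine ⟨k + 6, fun c => ?_⟩
  obtain ⟨n₀, hn₀⟩ := hk (2 * c + 1)
  refine ⟨max n₀ (2 ^ 16), fun n hn P hPdeg a ha t => ?_⟩
  have hn₀' : n₀ ≤ n := le_trans (le_max_left _ _) hn
  have hn16 : 2 ^ 16 ≤ n := le_trans (le_max_right _ _) hn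
  have hn3 : 3 ≤ n := le_trans (by norm_num) hn16
  have hSdeg : ∀ i, spliceLin a t P i ∈ Smolensky.lowDeg (ZMod 3) n ((Nat.log 2 n) ^ (2 * c + 1)) := fun i =>
    Smolensky.lowDeg_mono (degree_budget c n hn16) (spliceLin_mem_lowDeg a t hPdeg i)
  have hwin := hn₀ n hn₀' (spliceLin a t P) hSdeg
  have hsum := card_win_add_card_loss (fun y : Fin n → Bool => RingHLF.Rel y (fun i => decide (spliceLin a t P i y = 1)))
  have hloss : 1 / (n : ℝ) ^ k * (2 : ℝ) ^ n ≤
      ((univ.filter fun y : Fin n → Bool => ¬ RingHLF.Rel y (fun i => decide (spliceLin a t P i y = 1))).card : ℝ) := by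
    have e : (1 - 1 / (n : ℝ) ^ k) * (2 : ℝ) ^ n = (2 : ℝ) ^ n - 1 / (n : ℝ) ^ k * (2 : ℝ) ^ n := by ring
    linarith
  have htr' : ((univ.filter fun y : Fin n → Bool => ¬ RingHLF.Rel y (fun i => decide (spliceLin a t P i y = 1))).card : ℝ) ≤
      ((univ.filter fun x : Fin (n + 6) → Bool =>
        lin a x = t ∧ ¬ RingHLF.Rel x (fun b => decide (P b x = 1))).card : ℝ) := by
    exact_mod_cast card_loss_spliceLin_le hn3 ha t P
  have hnpos : (0 : ℝ) < n := by exact_mod_cast (show 0 < n by omega)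
  have hcmp : 1 / ((n + 6 : ℕ) : ℝ) ^ (k + 6) * (2 : ℝ) ^ (n + 6) ≤ 1 / (n : ℝ) ^ k * (2 : ℝ) ^ n := by
    have hNk : (n : ℝ) ^ k * 64 ≤ ((n + 6 : ℕ) : ℝ) ^ (k + 6) := by
      push_cast
      rw [pow_add]
      have h64 : (64 : ℝ) ≤ ((n : ℝ) + 6) ^ 6 := by
        calc (64 : ℝ) = 2 ^ 6 := by norm_num
          _ ≤ ((n : ℝ) + 6) ^ 6 := pow_le_pow_left₀ (by norm_num) (by linarith) 6
      have hk' : (n : ℝ) ^ k ≤ ((n : ℝ) + 6) ^ k := pow_le_pow_left₀ hnpos.le (by linarith) k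
      exact mul_le_mul hk' h64 (by norm_num) (by positivity)
    have hpos : (0 : ℝ) < (n : ℝ) ^ k * 64 := by positivity
    calc 1 / ((n + 6 : ℕ) : ℝ) ^ (k + 6) * (2 : ℝ) ^ (n + 6)
        ≤ 1 / ((n : ℝ) ^ k * 64) * (2 : ℝ) ^ (n + 6) :=
          mul_le_mul_of_nonneg_right (one_div_le_one_div_of_le hpos hNk) (by positivity)
      _ = 1 / (n : ℝ) ^ k * (2 : ℝ) ^ n := by
          rw [pow_add]
          field_simp
          norm_num
  exact hcmp.trans (hloss.trans htr')

/-- **RotLinRunLoss3 (PROVED): the same at EVERY ring offset** — every linear test whose coefficient vector is `≡ 1` on ANY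
six cyclically consecutive positions (`x ↦ ℓ_a(rot_s x)` is the linear form with coefficients `a ∘ rot_{-s}`).  In particular:
every sub-sum test `{Σ_{i∈S}[xᵢ] ≡ t (mod 3)}` for every `S ⊆ C_{n+6}` containing six consecutive ring positions (all
intervals of length `≥ 6`, all complements of sets missing a 6-run, …) — `3·(n+6)·3^n` tests, none of them a junta. -/
theorem rotLinRunLoss3_of_polyLoss3 (hP : SpreadDial.PolyLoss3) :
    ∃ k : ℕ, ∀ c : ℕ, ∃ n₀ : ℕ, ∀ n ≥ n₀, ∀ P : Fin (n + 6) → Smolensky.CubeFn (ZMod 3) (n + 6),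
      (∀ b, P b ∈ Smolensky.lowDeg (ZMod 3) (n + 6) ((Nat.log 2 (n + 6)) ^ c)) →
        ∀ a : Fin (n + 6) → ZMod 3, (∀ j : Fin 6, a (Fin.natAdd n j) = 1) → ∀ t : ZMod 3, ∀ s : ℕ,
          1 / ((n + 6 : ℕ) : ℝ) ^ k * (2 : ℝ) ^ (n + 6) ≤
            ((univ.filter fun x : Fin (n + 6) → Bool =>
              lin a (rot s x) = t ∧ ¬ RingHLF.Rel x (fun b => decide (P b x = 1))).card : ℝ) := by
  obtain ⟨k, hk⟩ := linRunLoss3_of_polyLoss3 hP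
  refine ⟨k, fun c => ?_⟩
  obtain ⟨n₀, hn₀⟩ := hk c
  refine ⟨n₀, fun n hn P hPdeg a ha t s => ?_⟩
  set s' := (n + 5) * s with hs'
  have hB := hn₀ n hn (rotStrat s s' P) (fun b => rotStrat_mem_lowDeg s s' hPdeg b) a ha t
  refine hB.trans ?_
  have hss : ∀ y : Fin (n + 6) → Bool, rot s (rot s' y) = y := fun y => by
    rw [RingSymmetry.rot_rot, show s + s' = (n + 6) * s by rw [hs']; ring]
    exact RingSymmetry.rot_mul_self s y
  have hle : (univ.filter fun y : Fin (n + 6) → Bool =>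
        lin a y = t ∧ ¬ RingHLF.Rel y (fun b => decide (rotStrat s s' P b y = 1))).card ≤
      (univ.filter fun x : Fin (n + 6) → Bool =>
        lin a (rot s x) = t ∧ ¬ RingHLF.Rel x (fun b => decide (P b x = 1))).card := by
    refine Finset.card_le_card_of_injOn (rot s') (fun y hy => ?_)
      (fun y _ y' _ h => RingSymmetry.rot_injective s' h)
    rw [Finset.mem_coe, Finset.mem_filter] at hy ⊢
    refine ⟨mem_univ _, by rw [hss]; exact hy.2.1, fun hwin => hy.2.2 ?_⟩
    have e : (fun b => decide (rotStrat s s' P b y = 1)) =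
        rot s (fun b => decide (P b (rot s' y) = 1)) := rfl
    rw [e]
    have := (RingSymmetry.rel_rot s (rot s' y) (fun b => decide (P b (rot s' y) = 1))).2 hwin
    rwa [hss] at this
  exact_mod_cast hle

/-- The sub-sum form of a set `S`: `ℓ_{1_S}(x) = Σ_{i ∈ S} [xᵢ]`. -/
theorem lin_indicator {N : ℕ} (S : Finset (Fin N)) (x : Fin N → Bool) :
    lin (fun i => if i ∈ S then (1 : ZMod 3) else 0) x = ∑ i ∈ S, (if x i then (1 : ZMod 3) else 0) := by
  unfold lin
  rw [← Finset.sum_filter_add_sum_filter_not univ (fun i => i ∈ S)]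
  have h1 : (univ.filter fun i : Fin N => i ∈ S) = S := by ext i; simp
  have h2 : ∑ i ∈ univ.filter (fun i : Fin N => ¬ i ∈ S), (if x i then (if i ∈ S then (1 : ZMod 3) else 0) else 0) = 0 := by
    refine Finset.sum_eq_zero (fun i hi => ?_)
    rw [Finset.mem_filter] at hi
    simp [hi.2]
  rw [h1, h2, add_zero]
  refine Finset.sum_congr rfl (fun i hi => ?_)
  simp [hi]

/-- **SubsumRunLoss3 (PROVED): every sub-sum test over a set containing a 6-run, at every offset.** -/
theorem subsumRunLoss3_of_polyLoss3 (hP : SpreadDial.PolyLoss3) :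
    ∃ k : ℕ, ∀ c : ℕ, ∃ n₀ : ℕ, ∀ n ≥ n₀, ∀ P : Fin (n + 6) → Smolensky.CubeFn (ZMod 3) (n + 6),
      (∀ b, P b ∈ Smolensky.lowDeg (ZMod 3) (n + 6) ((Nat.log 2 (n + 6)) ^ c)) →
        ∀ S : Finset (Fin (n + 6)), (∀ j : Fin 6, Fin.natAdd n j ∈ S) → ∀ t : ZMod 3, ∀ s : ℕ,
          1 / ((n + 6 : ℕ) : ℝ) ^ k * (2 : ℝ) ^ (n + 6) ≤
            ((univ.filter fun x : Fin (n + 6) → Bool =>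
              (∑ i ∈ S, (if rot s x i then (1 : ZMod 3) else 0)) = t ∧
                ¬ RingHLF.Rel x (fun b => decide (P b x = 1))).card : ℝ) := by
  obtain ⟨k, hk⟩ := rotLinRunLoss3_of_polyLoss3 hP
  refine ⟨k, fun c => ?_⟩
  obtain ⟨n₀, hn₀⟩ := hk c
  refine ⟨n₀, fun n hn P hPdeg S hS t s => ?_⟩
  have h := hn₀ n hn P hPdeg (fun i => if i ∈ S then (1 : ZMod 3) else 0) (fun j => by simp [hS j]) t s
  refine h.trans (le_of_eq ?_)
  congr 2
  refine Finset.filter_congr (fun x _ => ?_)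
  rw [lin_indicator]

end Linear

end Summit.QuantumAdvantage.QuantumAdvantage.Theorems.SteerDial
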